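import Summits.BirchSwinnertonDyer.Rank1Residual.Additive.X4SharpUnitFreeResidueNoLemma20
import Summits.BirchSwinnertonDyer.Rank1Residual.Additive.X4RankZeroKatoBoundManinFree
import Summits.BirchSwinnertonDyer.Rank1Residual.Additive.X4RankZeroKatoParity
import HarnessLib

/-!
# X4 ∧ `r = 0`, every odd `p`: the COVERED LOCUS and the PARITY closure WITHOUT any Manin /
# modular-parametrisation datum (and without the Wuthrich-Lemma-20 binder)
# (cell `b2b-bsdres`, seat additive-p4, GEN 18, line V34 part C; twin of V22/V23 on the fact A161′)

HONEST FRAMING (cell `b2b-bsdres`, run/shared/lean/b2b/bsd-rank1-residual/, verbatim in every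
file): the goal of the cell is to DELETE the COMBINATION-SHAPED residual classes of the
Birch–Swinnerton-Dyer formula for ALL analytic-rank `≤ 1` elliptic curves over `ℚ` — "full BSD
formula for every rank `≤ 1` curve in class `C`" assembled STRICTLY from published theorems — so
that the rank-`≤ 1` remainder becomes exactly the CONSTRUCTION-SHAPED classes, which are TYPED
(missing-input `Prop`s), NOT attempted. This is not "finishing BSD". Seat `additive-p4`
(CLASS-OWNERS row "X3♯/X4♯ direct", owner of the V22/V23/V25 chain of record): research route on
the CONSTRUCTION-SHAPED class X4; theorems only — no definition, no named fact minted; X4 stays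
CONSTRUCTION-SHAPED; no label or mark moves; nothing is booked.

## What this file proves

The chain of record for X4 ∧ `r_an = 0` at every odd `p` (V22 `X4RankZeroCoveredLocus.lean`, its
`hL20`-free twin by team n1011 p14 `…NoLemma20.lean`, the parity enlargement V23
`X4RankZeroKatoParity.lean`) read Kato 2004 Thm. 14.5 (3) on the potentially good rows through the
SHARP reading A161 (`hKatoS`), whose statement carries a modular-parametrisation datum `D` with
`p ∤ c_D` (Kato's Manin clause). Since 2026-08-21 the tree holds the MANIN-FREE reading A161′
(`Kato2004.rankZero_padicValNat_sha_le_sub_localTamagawa_of_additive_potGood_of_imageContainsSL2_maninFree`,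
n1011-lit / lit-kato, p252712: the period is `Ω(W)` of the globally minimal model, no datum at all;
A161′ ⟹ A161) and its first consumer `X4RankZero.missingUpperBoundAt_of_katoManinFree` (n1011 p08,
p253452). This file re-assembles the chain of record on A161′:

* §1 `X4RankZero.missingUpperBoundAt_of_facts_maninFree` — X4 ∧ `r_an = 0` ∧ surj(p) ∧
  **[`ord_p j < 0` ∨ (`ρ̄_{E,p^n}` onto ∀ `n` ∧ `ord_p ∏ c_ℓ = ord_p c_p`)]** ⟹ `MissingUpperBoundAt W p`
  at EVERY odd `p` — the COVERED LOCUS has NO Manin conjunct (and no `hL20`): binders A161′ `hKatoMF`,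
  Delbourgo Prop. 4 `hDel`, parametrisation EXISTENCE `hmodD` (used on the (M) branch only — it is
  Modularity: `nonempty_modularParametrizationData ↔ exists_isNewformOf` in the tree), Kato half-eigen
  `hKatoχ`, GZK, modularity; `…missingPPartAt_iff_lower_of_facts_maninFree`,
  `…bsdp_of_facts_of_lower_maninFree`, **`…bsdp_of_facts_of_shaAn_unit_maninFree`** (BSD_p on the
  covered locus ∧ `p ∤ #Ш_an`), `…_of_five_le_maninFree` (`p ≥ 5`: certificate = `p ∤ ∏ c_ℓ` ALONE).
* §2 parity, datum-free: `X4RankZero.even_padicValNat_shaOrder_and_le_of_katoManinFree`,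
  **`X4RankZero.bsdp_of_katoManinFree_of_casselsTate_of_tamDefect_le_one`** (pot-good ∧ tower ∧
  `ord_p ∏c ≤ v_p(c_p)+1` ∧ `p ∤ #Ш_an` ⟹ BSD_p), `…missingUpperBoundAt_…_of_even`,
  `…bsdp_three_of_cert_of_tamDefect_le_one_of_casselsTate_maninFree` (`p = 3` census shape: tower by
  `j`-witness / surj(9)), `…bsdp_of_casselsTate_of_tamDefect_le_one_of_five_le_maninFree` (`p ≥ 5`:
  surj ∧ `p² ∤ ∏c` ∧ `p ∤ #Ш_an` ⟹ BSD_p — NO datum, NO image certificate),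
  **`X4RankZero.bsdp_of_facts_of_casselsTate_of_shaAn_unit_maninFree`** (the covered locus enlarged by
  parity, five named facts `hCT hKatoMF hDel hmodD hKatoχ` + GZK + modularity).

The END-STATE equivalences without MANIN♭ are the sibling `X4SharpUnitFreeResidueManinFree.lean`.
Registry effect (lit / referee's call): on class X4 ∧ `r = 0` no theorem of record carries a Manin or
optimality binder any more — the MANIN♭ residue of RESIDUAL-MAP §I N10/N11 (X4 part) is VOID on the
Kato side at every odd `p`. The flag `Kato-14.5(3)-14.16(2)-additive-potgood-reading-sharp` (tier D
reading-fact) travels with every theorem here exactly as with the A161 forms. Nothing booked.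

References: Kato 2004 [Kato2004Asterisque] Thm. 14.5 (3) (p. 236), Prop. 14.16 (2) (p. 244),
Thm. 17.4 (3) (p. 273); Delbourgo 1998 [Delbourgo1998] Prop. 4 (p. 144); Cassels 1962 / Silverman
*AEC* X.4.14 [SilvermanAEC2009]; Serre 1972 [Serre1972] IV §3.4; Miller 2011 [Miller2011LMS] Def. 1.1.
-/

noncomputable section

open scoped Classical

open WeierstrassCurve Literature.NumberTheory.EllipticCurves
  Literature.NumberTheory.EllipticCurves.ModularForms
  Literature.NumberTheory.EllipticCurves.Rank1Residual
  Literature.NumberTheory.EllipticCurves.Rank1Residual.Typed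

namespace Summit.BirchSwinnertonDyer.Rank1Residual.Additive

variable (W : WeierstrassCurve ℚ) [W.IsElliptic] [W.IsGloballyMinimal] (p : ℕ) [hp : Fact p.Prime]

/-! ### §1 The covered locus, every odd `p` — no Manin datum, no `hL20` -/

/-- **THE UPPER HALF ON THE COVERED LOCUS, every odd `p`, WITHOUT any Manin datum**: X4 ∧ `r_an = 0`
∧ surj(p) ∧ [`ord_p j < 0` ∨ (`ρ̄_{E,p^n}` onto ∀ `n` ∧ `ord_p ∏ c_ℓ = ord_p c_p`)] ⟹
`ord_p #Ш(E) ≤ ord_p #Ш_an(E)` — the (M) branch by additive-p1's `ω^{(p−1)/2}`-branch theorem in p14's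
`hL20`-free form, the potentially good branch by the Manin-free sharp Kato reading (p08's
`X4RankZero.missingUpperBoundAt_of_katoManinFree`). [cite: Kato2004Asterisque, Thm. 14.5 (3) (p. 236), Thm. 17.4 (3) (p. 273)]
[cite: Delbourgo1998, Prop. 4 (p. 144)] [cite: Miller2011LMS, Def. 1.1] -/
theorem X4RankZero.missingUpperBoundAt_of_facts_maninFree
    (hKatoMF : Kato2004.rankZero_padicValNat_sha_le_sub_localTamagawa_of_additive_potGood_of_imageContainsSL2_maninFree)
    (hDel : Delbourgo1998.prop4_rankZero_pow_dvd_constantCoeff)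
    (hGZK : rank_eq_analyticRank_of_analyticRank_le_one) (hmod : hasEntireLFunction_rat)
    (hmodD : nonempty_modularParametrizationData)
    (hKatoχ : Wuthrich2014.kato_halfEigenCharIdeal_dvd_cyclotomicPrime_of_surjective)
    (hr : W.analyticRank = 0) (hX : ClassX4 W p) (hsurj : Surj W p)
    (hcov : padicValRat p W.j < 0 ∨
      ((∀ n : ℕ, W.HasSurjectiveModNGaloisRep (p ^ n : ℕ)) ∧
        padicValNat p W.tamagawaProduct =
          padicValNat p ((W.baseChange ℚ_[p]).localTamagawaNumber ℤ_[p]))) :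
    MissingUpperBoundAt W p := by
  by_cases hj : padicValRat p W.j < 0
  · exact AdditivePotMult.ClassX4M.missingUpperBoundAt_rankZero_of_surj_noL20 hDel hGZK hmod hmodD
      hKatoχ ⟨hX, hX.2.1, hj⟩ hr hsurj
  · obtain ⟨htower, htam⟩ := hcov.resolve_left hj
    exact X4RankZero.missingUpperBoundAt_of_katoManinFree W p hKatoMF hGZK hmod hr hX (not_lt.mp hj)
      htower htam

/-- **`p ≥ 5`: the certificate part of the covered locus is `p ∤ ∏ c_ℓ` ALONE** (tower by Serre,
`ord_p ∏c = ord_p c_p ⟺ p ∤ ∏c` at an additive `p ≥ 5`; NO datum). [cite: Kato2004Asterisque, Thm. 14.5 (3) (p. 236)]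
[cite: Serre1972, IV §3.4] [cite: SilvermanATAEC1994, Cor. IV.9.2 (d) (PDF p. 340)] [cite: Miller2011LMS, Def. 1.1] -/
theorem X4RankZero.missingUpperBoundAt_of_facts_of_five_le_maninFree
    (hKatoMF : Kato2004.rankZero_padicValNat_sha_le_sub_localTamagawa_of_additive_potGood_of_imageContainsSL2_maninFree)
    (hDel : Delbourgo1998.prop4_rankZero_pow_dvd_constantCoeff)
    (hGZK : rank_eq_analyticRank_of_analyticRank_le_one) (hmod : hasEntireLFunction_rat)
    (hmodD : nonempty_modularParametrizationData)
    (hKatoχ : Wuthrich2014.kato_halfEigenCharIdeal_dvd_cyclotomicPrime_of_surjective)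
    (hp5 : 5 ≤ p) (hr : W.analyticRank = 0) (hX : ClassX4 W p) (hsurj : Surj W p)
    (hcov : padicValRat p W.j < 0 ∨ ¬ p ∣ W.tamagawaProduct) : MissingUpperBoundAt W p := by
  refine X4RankZero.missingUpperBoundAt_of_facts_maninFree W p hKatoMF hDel hGZK hmod hmodD hKatoχ hr hX
    hsurj (hcov.imp_right fun htam ↦ ⟨towerSurj_of_surj_of_ne_three W p hX hsurj (by omega), ?_⟩)
  exact (padicValNat_tamagawaProduct_eq_local_iff_not_dvd_of_addv W p hX.2.1 hp5).mpr htam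

/-- **On the covered locus the typed input is EXACTLY the lower half**, every odd `p`, no datum.
[cite: Kato2004Asterisque, Thm. 14.5 (3) (p. 236)] [cite: Delbourgo1998, Prop. 4 (p. 144)]
[cite: Miller2011LMS, Def. 1.1] -/
theorem X4RankZero.missingPPartAt_iff_lower_of_facts_maninFree
    (hKatoMF : Kato2004.rankZero_padicValNat_sha_le_sub_localTamagawa_of_additive_potGood_of_imageContainsSL2_maninFree)
    (hDel : Delbourgo1998.prop4_rankZero_pow_dvd_constantCoeff)
    (hGZK : rank_eq_analyticRank_of_analyticRank_le_one) (hmod : hasEntireLFunction_rat)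
    (hmodD : nonempty_modularParametrizationData)
    (hKatoχ : Wuthrich2014.kato_halfEigenCharIdeal_dvd_cyclotomicPrime_of_surjective)
    (hr : W.analyticRank = 0) (hX : ClassX4 W p) (hsurj : Surj W p)
    (hcov : padicValRat p W.j < 0 ∨
      ((∀ n : ℕ, W.HasSurjectiveModNGaloisRep (p ^ n : ℕ)) ∧
        padicValNat p W.tamagawaProduct =
          padicValNat p ((W.baseChange ℚ_[p]).localTamagawaNumber ℤ_[p]))) :
    MissingPPartAt W p ↔ MissingLowerBoundAt W p :=
  ⟨fun h ↦ (lower_and_upper_of_missingPPartAt W p h).1, fun h ↦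
    missingPPartAt_of_lower_of_upper W p h
      (X4RankZero.missingUpperBoundAt_of_facts_maninFree W p hKatoMF hDel hGZK hmod hmodD hKatoχ hr hX
        hsurj hcov)⟩

/-- **`BSD(E,p)` on the covered locus from the LOWER half alone**, every odd `p`, no datum.
[cite: Kato2004Asterisque, Thm. 14.5 (3) (p. 236)] [cite: Delbourgo1998, Prop. 4 (p. 144)]
[cite: Miller2011LMS, §1 and Def. 1.1] -/
theorem X4RankZero.bsdp_of_facts_of_lower_maninFree
    (hKatoMF : Kato2004.rankZero_padicValNat_sha_le_sub_localTamagawa_of_additive_potGood_of_imageContainsSL2_maninFree)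
    (hDel : Delbourgo1998.prop4_rankZero_pow_dvd_constantCoeff)
    (hGZK : rank_eq_analyticRank_of_analyticRank_le_one) (hmod : hasEntireLFunction_rat)
    (hmodD : nonempty_modularParametrizationData)
    (hKatoχ : Wuthrich2014.kato_halfEigenCharIdeal_dvd_cyclotomicPrime_of_surjective)
    (hr : W.analyticRank = 0) (hX : ClassX4 W p) (hsurj : Surj W p)
    (hcov : padicValRat p W.j < 0 ∨
      ((∀ n : ℕ, W.HasSurjectiveModNGaloisRep (p ^ n : ℕ)) ∧
        padicValNat p W.tamagawaProduct =
          padicValNat p ((W.baseChange ℚ_[p]).localTamagawaNumber ℤ_[p])))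
    (hlow : MissingLowerBoundAt W p) : BSDp W p :=
  bsdp_of_missingPPartAt W p hGZK (by rw [hr]; exact zero_le_one)
    ((X4RankZero.missingPPartAt_iff_lower_of_facts_maninFree W p hKatoMF hDel hGZK hmod hmodD hKatoχ hr
      hX hsurj hcov).mpr hlow)

/-- **THE CHAIN OF RECORD FOR X4 ∧ `r = 0` AT EVERY ODD `p`, MANIN-FREE: `BSD(E,p)` on the covered
locus [`ord_p j < 0` ∨ (tower ∧ `ord_p ∏ c_ℓ = ord_p c_p`)] when `#Ш_an(E)` is a `p`-unit** — FOUR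
named published facts (`hKatoMF`, `hDel`, `hmodD`, `hKatoχ`) + GZK + modularity; no datum, no `hL20`.
[cite: Kato2004Asterisque, Thm. 14.5 (3) (p. 236), Thm. 17.4 (3) (p. 273)] [cite: Delbourgo1998, Prop. 4 (p. 144)]
[cite: Miller2011LMS, §1 and Def. 1.1] -/
theorem X4RankZero.bsdp_of_facts_of_shaAn_unit_maninFree
    (hKatoMF : Kato2004.rankZero_padicValNat_sha_le_sub_localTamagawa_of_additive_potGood_of_imageContainsSL2_maninFree)
    (hDel : Delbourgo1998.prop4_rankZero_pow_dvd_constantCoeff)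
    (hGZK : rank_eq_analyticRank_of_analyticRank_le_one) (hmod : hasEntireLFunction_rat)
    (hmodD : nonempty_modularParametrizationData)
    (hKatoχ : Wuthrich2014.kato_halfEigenCharIdeal_dvd_cyclotomicPrime_of_surjective)
    (hr : W.analyticRank = 0) (hX : ClassX4 W p) (hsurj : Surj W p)
    (hcov : padicValRat p W.j < 0 ∨
      ((∀ n : ℕ, W.HasSurjectiveModNGaloisRep (p ^ n : ℕ)) ∧
        padicValNat p W.tamagawaProduct =
          padicValNat p ((W.baseChange ℚ_[p]).localTamagawaNumber ℤ_[p])))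
    {q : ℚ} (hq : shaAn W = (q : ℂ)) (hv : padicValRat p q = 0) : BSDp W p :=
  bsdp_of_missingPPartAt W p hGZK (by rw [hr]; exact zero_le_one)
    (missingPPartAt_of_upper_of_shaAn_unit W p
      (X4RankZero.missingUpperBoundAt_of_facts_maninFree W p hKatoMF hDel hGZK hmod hmodD hKatoχ hr hX
        hsurj hcov) hq hv)

/-- **`p ≥ 5` chain of record, MANIN-FREE**: X4 ∧ `r_an = 0` ∧ surj(p) ∧ [`ord_p j < 0` ∨ `p ∤ ∏ c_ℓ`]
∧ `p ∤ #Ш_an` ⟹ `BSD(E,p)` — every binder decided by Cremona's `allbsd` columns; no datum, no image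
certificate. [cite: Kato2004Asterisque, Thm. 14.5 (3) (p. 236)] [cite: Serre1972, IV §3.4]
[cite: Miller2011LMS, §1 and Def. 1.1] -/
theorem X4RankZero.bsdp_of_facts_of_shaAn_unit_of_five_le_maninFree
    (hKatoMF : Kato2004.rankZero_padicValNat_sha_le_sub_localTamagawa_of_additive_potGood_of_imageContainsSL2_maninFree)
    (hDel : Delbourgo1998.prop4_rankZero_pow_dvd_constantCoeff)
    (hGZK : rank_eq_analyticRank_of_analyticRank_le_one) (hmod : hasEntireLFunction_rat)
    (hmodD : nonempty_modularParametrizationData)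
    (hKatoχ : Wuthrich2014.kato_halfEigenCharIdeal_dvd_cyclotomicPrime_of_surjective)
    (hp5 : 5 ≤ p) (hr : W.analyticRank = 0) (hX : ClassX4 W p) (hsurj : Surj W p)
    (hcov : padicValRat p W.j < 0 ∨ ¬ p ∣ W.tamagawaProduct)
    {q : ℚ} (hq : shaAn W = (q : ℂ)) (hv : padicValRat p q = 0) : BSDp W p :=
  bsdp_of_missingPPartAt W p hGZK (by rw [hr]; exact zero_le_one)
    (missingPPartAt_of_upper_of_shaAn_unit W p
      (X4RankZero.missingUpperBoundAt_of_facts_of_five_le_maninFree W p hKatoMF hDel hGZK hmod hmodD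
        hKatoχ hp5 hr hX hsurj hcov) hq hv)

/-! ### §2 The parity enlargement, every odd `p` — no Manin datum -/

/-- **X4 ∧ `r_an = 0` ∧ `ord_p j ≥ 0` ∧ tower, every odd `p`, NO datum: `ord_p #Ш(E)` is EVEN and
`≤ ord_p #Ш_an + ord_p ∏ c_ℓ − v_p(c_p)`** (Manin-free sharp Kato + Cassels–Tate).
[cite: Kato2004Asterisque, Thm. 14.5 (3) (p. 236), Prop. 14.16 (2) (p. 244)] [cite: SilvermanAEC2009, Thm. X.4.14] -/
theorem X4RankZero.even_padicValNat_shaOrder_and_le_of_katoManinFree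
    (hCT : exists_casselsTate_pairing (K := ℚ))
    (hKatoMF : Kato2004.rankZero_padicValNat_sha_le_sub_localTamagawa_of_additive_potGood_of_imageContainsSL2_maninFree)
    (hGZK : rank_eq_analyticRank_of_analyticRank_le_one) (hmod : hasEntireLFunction_rat)
    (hr : W.analyticRank = 0) (hX : ClassX4 W p) (hpot : 0 ≤ padicValRat p W.j)
    (htower : ∀ n : ℕ, W.HasSurjectiveModNGaloisRep (p ^ n : ℕ)) :
    Even (padicValNat p W.shaOrder) ∧ ∃ q : ℚ, shaAn W = (q : ℂ) ∧
      (padicValNat p W.shaOrder : ℤ) ≤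
        padicValRat p q + padicValNat p W.tamagawaProduct -
          padicValNat p ((W.baseChange ℚ_[p]).localTamagawaNumber ℤ_[p]) := by
  have hfin : W.ShaFinite := (hGZK W (by rw [hr]; exact zero_le_one)).2
  refine ⟨?_, X4RankZero.padicValNat_shaOrder_le_of_katoManinFree W p hKatoMF hGZK hmod hr hX hpot htower⟩
  obtain ⟨r, hr2⟩ := isSquare_shaOrder_of_casselsTate hCT W hfin
  have hn : W.shaOrder ≠ 0 := (WeierstrassCurve.shaOrder_pos W hfin).ne'
  have hr0 : r ≠ 0 := fun h ↦ hn (by simp [hr2, h])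
  rw [hr2, padicValNat.mul hr0 hr0]
  exact ⟨_, rfl⟩

/-- **PARITY CLOSURE at every odd `p`, NO datum** (`p = 3` included): X4 ∧ `r_an = 0` ∧ `ord_p j ≥ 0`
∧ tower ∧ `ord_p ∏ c_ℓ ≤ v_p(c_p) + 1` ∧ `#Ш_an = q` a `p`-unit ⟹ `BSD(E,p)`.
[cite: Kato2004Asterisque, Thm. 14.5 (3) (p. 236), Prop. 14.16 (2) (p. 244)] [cite: SilvermanAEC2009, Thm. X.4.14]
[cite: Miller2011LMS, §1 and Def. 1.1] -/
theorem X4RankZero.bsdp_of_katoManinFree_of_casselsTate_of_tamDefect_le_one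
    (hCT : exists_casselsTate_pairing (K := ℚ))
    (hKatoMF : Kato2004.rankZero_padicValNat_sha_le_sub_localTamagawa_of_additive_potGood_of_imageContainsSL2_maninFree)
    (hGZK : rank_eq_analyticRank_of_analyticRank_le_one) (hmod : hasEntireLFunction_rat)
    (hr : W.analyticRank = 0) (hX : ClassX4 W p) (hpot : 0 ≤ padicValRat p W.j)
    (htower : ∀ n : ℕ, W.HasSurjectiveModNGaloisRep (p ^ n : ℕ))
    (htam : padicValNat p W.tamagawaProduct ≤
      padicValNat p ((W.baseChange ℚ_[p]).localTamagawaNumber ℤ_[p]) + 1)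
    {q : ℚ} (hq : shaAn W = (q : ℂ)) (hv : padicValRat p q = 0) : BSDp W p := by
  have hfin : W.ShaFinite := (hGZK W (by rw [hr]; exact zero_le_one)).2
  have hsq : IsSquare W.shaOrder := isSquare_shaOrder_of_casselsTate hCT W hfin
  have hn : W.shaOrder ≠ 0 := (WeierstrassCurve.shaOrder_pos W hfin).ne'
  obtain ⟨-, q', hq', hle⟩ :=
    X4RankZero.even_padicValNat_shaOrder_and_le_of_katoManinFree W p hCT hKatoMF hGZK hmod hr hX hpot
      htower
  have hqq : q' = q := by exact_mod_cast hq'.symm.trans hq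
  subst hqq
  rw [hv, zero_add] at hle
  have hle1 : padicValNat p W.shaOrder ≤ 1 := by
    have htam' : (padicValNat p W.tamagawaProduct : ℤ) ≤
        padicValNat p ((W.baseChange ℚ_[p]).localTamagawaNumber ℤ_[p]) + 1 := by exact_mod_cast htam
    have : (padicValNat p W.shaOrder : ℤ) ≤ 1 := by linarith
    exact_mod_cast this
  have h0 : padicValNat p W.shaOrder = 0 := padicValNat_eq_zero_of_isSquare_of_le_one hsq hn hle1
  exact bsdp_of_missingPPartAt W p hGZK (by rw [hr]; exact zero_le_one)
    ⟨q', hq', by rw [hv, h0, Nat.cast_zero]⟩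

/-- **The typed UPPER half on the Tamagawa-defect-one rows with `ord_p #Ш_an` EVEN, NO datum**:
X4 ∧ `r_an = 0` ∧ `ord_p j ≥ 0` ∧ tower ∧ `ord_p ∏ c_ℓ ≤ v_p(c_p) + 1` ∧ `#Ш_an = q`, `ord_p q` even ⟹
`MissingUpperBoundAt W p`. [cite: Kato2004Asterisque, Thm. 14.5 (3) (p. 236)]
[cite: SilvermanAEC2009, Thm. X.4.14] [cite: Miller2011LMS, Def. 1.1] -/
theorem X4RankZero.missingUpperBoundAt_of_katoManinFree_of_casselsTate_of_tamDefect_le_one_of_even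
    (hCT : exists_casselsTate_pairing (K := ℚ))
    (hKatoMF : Kato2004.rankZero_padicValNat_sha_le_sub_localTamagawa_of_additive_potGood_of_imageContainsSL2_maninFree)
    (hGZK : rank_eq_analyticRank_of_analyticRank_le_one) (hmod : hasEntireLFunction_rat)
    (hr : W.analyticRank = 0) (hX : ClassX4 W p) (hpot : 0 ≤ padicValRat p W.j)
    (htower : ∀ n : ℕ, W.HasSurjectiveModNGaloisRep (p ^ n : ℕ))
    (htam : padicValNat p W.tamagawaProduct ≤
      padicValNat p ((W.baseChange ℚ_[p]).localTamagawaNumber ℤ_[p]) + 1)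
    {q : ℚ} (hq : shaAn W = (q : ℂ)) (heven : Even (padicValRat p q)) :
    MissingUpperBoundAt W p := by
  obtain ⟨hevenSha, q', hq', hle⟩ :=
    X4RankZero.even_padicValNat_shaOrder_and_le_of_katoManinFree W p hCT hKatoMF hGZK hmod hr hX hpot
      htower
  have hqq : q' = q := by exact_mod_cast hq'.symm.trans hq
  subst hqq
  refine ⟨q', hq', ?_⟩
  have htam' : (padicValNat p W.tamagawaProduct : ℤ) ≤
      padicValNat p ((W.baseChange ℚ_[p]).localTamagawaNumber ℤ_[p]) + 1 := by exact_mod_cast htam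
  have hB : (padicValNat p W.shaOrder : ℤ) ≤ padicValRat p q' + 1 := by linarith
  have hodd : Odd (padicValRat p q' + 1) := heven.add_one
  have := Nat.cast_le_sub_one_of_even_of_odd hevenSha hodd hB
  linarith

/-- **`p = 3` census shape, NO datum — the N11 Tamagawa-defect-one rows**: X4 ∧ `r_an = 0` ∧
`ord₃ j ≥ 0` ∧ surj(3) ∧ [`j`-witness ∨ surj(9)] ∧ `ord₃ ∏ c_ℓ ≤ v₃(c₃) + 1` ∧ `3 ∤ #Ш_an` ⟹ `BSD(E,3)`.
[cite: Kato2004Asterisque, Thm. 14.5 (3) (p. 236), (12.5.2) (p. 222)] [cite: SilvermanAEC2009, Thm. X.4.14]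
[cite: Miller2011LMS, §1 and Def. 1.1] -/
theorem X4RankZero.bsdp_three_of_cert_of_tamDefect_le_one_of_casselsTate_maninFree
    (hCT : exists_casselsTate_pairing (K := ℚ))
    (hKatoMF : Kato2004.rankZero_padicValNat_sha_le_sub_localTamagawa_of_additive_potGood_of_imageContainsSL2_maninFree)
    (hGZK : rank_eq_analyticRank_of_analyticRank_le_one) (hmod : hasEntireLFunction_rat)
    (hr : W.analyticRank = 0) (hX : ClassX4 W 3) (hpot : 0 ≤ padicValRat 3 W.j) (hsurj : Surj W 3)
    (hcert : (∃ q : ℕ, q.Prime ∧ q ≠ 3 ∧ padicValRat q W.j < 0 ∧ ¬ (3 : ℤ) ∣ padicValRat q W.j) ∨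
      W.HasSurjectiveModNGaloisRep 9)
    (htam : padicValNat 3 W.tamagawaProduct ≤
      padicValNat 3 ((WeierstrassCurve.baseChange W ℚ_[3]).localTamagawaNumber ℤ_[3]) + 1)
    {q : ℚ} (hq : shaAn W = (q : ℂ)) (hv : padicValRat 3 q = 0) : BSDp W 3 :=
  X4RankZero.bsdp_of_katoManinFree_of_casselsTate_of_tamDefect_le_one W 3 hCT hKatoMF hGZK hmod hr hX
    hpot (towerSurj_three_of_surj_of_jWitness_or_nine W hsurj hcert) htam hq hv

/-- **`p ≥ 5` census shape, NO datum and NO image certificate**: X4 ∧ `r_an = 0` ∧ `ord_p j ≥ 0` ∧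
surj(p) ∧ `p² ∤ ∏ c_ℓ` ∧ `p ∤ #Ш_an` ⟹ `BSD(E,p)` (tower by Serre, `v_p(c_p) = 0` by Kodaira–Néron).
[cite: Kato2004Asterisque, Thm. 14.5 (3) (p. 236)] [cite: SilvermanAEC2009, Thm. X.4.14]
[cite: Serre1972, IV §3.4] [cite: SilvermanATAEC1994, Cor. IV.9.2 (d) (PDF p. 340)] [cite: Miller2011LMS, §1 and Def. 1.1] -/
theorem X4RankZero.bsdp_of_casselsTate_of_tamDefect_le_one_of_five_le_maninFree
    (hCT : exists_casselsTate_pairing (K := ℚ))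
    (hKatoMF : Kato2004.rankZero_padicValNat_sha_le_sub_localTamagawa_of_additive_potGood_of_imageContainsSL2_maninFree)
    (hGZK : rank_eq_analyticRank_of_analyticRank_le_one) (hmod : hasEntireLFunction_rat)
    (hp5 : 5 ≤ p) (hr : W.analyticRank = 0) (hX : ClassX4 W p) (hpot : 0 ≤ padicValRat p W.j)
    (hsurj : Surj W p) (htam : ¬ p ^ 2 ∣ W.tamagawaProduct)
    {q : ℚ} (hq : shaAn W = (q : ℂ)) (hv : padicValRat p q = 0) : BSDp W p :=
  X4RankZero.bsdp_of_katoManinFree_of_casselsTate_of_tamDefect_le_one W p hCT hKatoMF hGZK hmod hr hX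
    hpot (serre_hasSurjectiveModNGaloisRep_pow_holds W p hp5 hsurj)
    (by
      rw [padicValNat_localTamagawaNumber_padic_eq_zero_of_addv W p hX.2.1 hp5, zero_add]
      exact padicValNat_le_one_of_not_sq_dvd (W.tamagawaProduct_pos_holds).ne' htam) hq hv

/-- **THE CHAIN OF RECORD FOR X4 ∧ `r = 0` AT EVERY ODD `p`, PARITY FORM, MANIN-FREE**: X4 ∧
`r_an = 0` ∧ surj(p) ∧ [`ord_p j < 0` ∨ (`ρ̄_{E,p^n}` onto ∀ `n` ∧ `ord_p ∏ c_ℓ ≤ v_p(c_p) + 1`)] ∧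
`p ∤ #Ш_an` ⟹ `BSD(E,p)` — FIVE named facts (`hCT`, `hKatoMF`, `hDel`, `hmodD`, `hKatoχ`) + GZK +
modularity; no datum, no `hL20`. [cite: Kato2004Asterisque, Thm. 14.5 (3) (p. 236), Thm. 17.4 (3) (p. 273)]
[cite: Delbourgo1998, Prop. 4 (p. 144)] [cite: SilvermanAEC2009, Thm. X.4.14] [cite: Miller2011LMS, §1 and Def. 1.1] -/
theorem X4RankZero.bsdp_of_facts_of_casselsTate_of_shaAn_unit_maninFree
    (hCT : exists_casselsTate_pairing (K := ℚ))
    (hKatoMF : Kato2004.rankZero_padicValNat_sha_le_sub_localTamagawa_of_additive_potGood_of_imageContainsSL2_maninFree)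
    (hDel : Delbourgo1998.prop4_rankZero_pow_dvd_constantCoeff)
    (hGZK : rank_eq_analyticRank_of_analyticRank_le_one) (hmod : hasEntireLFunction_rat)
    (hmodD : nonempty_modularParametrizationData)
    (hKatoχ : Wuthrich2014.kato_halfEigenCharIdeal_dvd_cyclotomicPrime_of_surjective)
    (hr : W.analyticRank = 0) (hX : ClassX4 W p) (hsurj : Surj W p)
    (hcov : padicValRat p W.j < 0 ∨
      ((∀ n : ℕ, W.HasSurjectiveModNGaloisRep (p ^ n : ℕ)) ∧
        padicValNat p W.tamagawaProduct ≤
          padicValNat p ((W.baseChange ℚ_[p]).localTamagawaNumber ℤ_[p]) + 1))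
    {q : ℚ} (hq : shaAn W = (q : ℂ)) (hv : padicValRat p q = 0) : BSDp W p := by
  by_cases hj : padicValRat p W.j < 0
  · exact X4RankZero.bsdp_of_facts_of_shaAn_unit_maninFree W p hKatoMF hDel hGZK hmod hmodD hKatoχ hr
      hX hsurj (Or.inl hj) hq hv
  · obtain ⟨htower, htam⟩ := hcov.resolve_left hj
    exact X4RankZero.bsdp_of_katoManinFree_of_casselsTate_of_tamDefect_le_one W p hCT hKatoMF hGZK hmod
      hr hX (not_lt.mp hj) htower htam hq hv

end Summit.BirchSwinnertonDyer.Rank1Residual.Additive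

end
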